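import Mathlib.Algebra.Order.Chebyshev
import Mathlib.Data.Nat.Choose.Sum
import Mathlib.Algebra.BigOperators.Fin
import Mathlib.Logic.Equiv.Fin.Basic
import Mathlib.Tactic.IntervalCases
import Mathlib.Tactic.Positivity
import Mathlib.Tactic.Linarith
import Mathlib.Tactic.Ring
import HarnessLib
import HarnessLib.Audit

/-!
# `GCT/Max`: S-F-6 arithmetic — the leading-term count `LT`, the stage-2 per-`k` criterion (`m = 3`, `n ≥ 8`),
# and the smoothing `C(n,k+1)²·C(n²,p) ≤ n²·LT` (Chebyshev twice + hockey stick)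

Cell `pub-gct-max` (HOME `run/shared/lean/pub/pub-gct-max/`), track F, Lean port S-F-6 of the located negative C-F-3′ /
N-F-1 "plain Koszul–Young flattenings do not separate the padded `3 × 3` permanent from `det_n`" (lead D53/D65; referee read
2026-08-23T04:57:52Z, no objection). THIS MODULE = the pure-arithmetic layer, written and kernel-checked by theory-2
(`lean-scratch/SF6Assembly.lean` sha256/16 `070a324692f9b2dc`, parts 1–3), re-homed under the inter-cell NAMING RULE
(`Summits/PneNP/GCT/Max/`) by lit-2 with docstrings; mathematics: memo `CF3-THEOREM.md` §3a, §4 (theory-2). Mathlib only;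
everything PROVED; no conjecture of the cell is used or asserted. HONEST FRAMING: multiplicity data and certified rank bounds
at small parameters; occurrence obstructions are ruled out in print (BIP'16) — multiplicity obstructions are the open door;
nothing here is a claim on VP vs VNP or P vs NP.

**Contents.** `DetKYLeadingTerms.ltCount n c k = Σ_{i,j<n} C(i,k)·C(j,k)·C(i·n+j, c)` (the size of the leading-term family of
`det_n`, module `DetKYLeadingTermsFamily`/`DetKYLeadingTerms`; target exponent `c = n²-1-p`); `SF6Stage2.S3 k = Σ_{l ≤ min k 3}
C(3,l)²` and the per-`k` criterion `SF6Stage2.perk_criterion_m3 : 8 ≤ n → k ≤ (n-1)/2 → S3 k · n² ≤ C(n,k+1)²` (sharp: fails at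
`n = 7`, `k = 1`); the smoothing `SF6Smoothing.lambda1_le : C(n,k+1)²·C(n²,p) ≤ n²·ltCount n (n²-1-p) k`; and the glue
`SF6Glue.stage2_primal_cell : S3 k · C(n²,p) ≤ ltCount n (n²-1-p) k` (`n ≥ 8`, `k ≤ (n-1)/2`, `p+1 ≤ n²`), packaged as the
statement `SF6StageTwoCellBound` with `sF6StageTwoCellBound_holds`.
-/

namespace Summit.PneNP.GCT

namespace DetKYLeadingTerms

open Finset in
/-- The leading-term count `ltCount(n, c, k) = Σ_{i,j<n} C(i,k)·C(j,k)·C(i·n+j, c)` (rows/columns `0`-indexed, row `i`, column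
`j`, position `i·n+j`; target exponent `c = n²-1-p`): the number of members of the leading-term family `𝒟(n,c,k)` of `det_n`
(CF3-THEOREM §2; `card_Idx` in module `DetKYLeadingTerms`). [folklore] -/
def ltCount (n c k : ℕ) : ℕ :=
  ∑ i : Fin n, ∑ j : Fin n, (i : ℕ).choose k * (j : ℕ).choose k * ((i : ℕ) * n + j).choose c

end DetKYLeadingTerms

namespace SF6Stage2

open Finset

/-- `S3 k = Σ_{l=0}^{min k 3} C(3,l)^2`. -/
def S3 (k : ℕ) : ℕ := ∑ l ∈ range (min k 3 + 1), (Nat.choose 3 l) ^ 2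

/-- `S3 0 = 1`. [folklore] -/
lemma S3_zero : S3 0 = 1 := by decide
/-- `S3 1 = 10`. [folklore] -/
lemma S3_one : S3 1 = 10 := by decide
/-- `S3 2 = 19`. [folklore] -/
lemma S3_two : S3 2 = 19 := by decide
example : S3 3 = 20 := by decide

/-- `S3 k = 20` for `k ≥ 3`. [folklore] -/
lemma S3_of_three_le (k : ℕ) (hk : 3 ≤ k) : S3 k = 20 := by
  unfold S3
  rw [min_eq_right hk]
  decide

/-- `2·C(t+2,2) = (t+2)(t+1)`. -/
private lemma two_mul_choose_two (t : ℕ) : 2 * (t + 2).choose 2 = (t + 2) * (t + 1) := by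
  have h := Nat.add_one_mul_choose_eq (t + 1) 1
  -- h : (t+2) * (t+1).choose 1 = (t+2).choose 2 * 2
  simp [Nat.choose_one_right] at h
  linarith [h]

/-- `6·C(t+3,3) = (t+3)(t+2)(t+1)`. -/
private lemma six_mul_choose_three (t : ℕ) : 6 * (t + 3).choose 3 = (t + 3) * (t + 2) * (t + 1) := by
  have h := Nat.add_one_mul_choose_eq (t + 2) 2
  -- h : (t+3) * (t+2).choose 2 = (t+3).choose 3 * 3
  have h2 := two_mul_choose_two t
  nlinarith [h, h2]

/-- `24·C(t+4,4) = (t+4)(t+3)(t+2)(t+1)`. -/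
private lemma tf_mul_choose_four (t : ℕ) :
    24 * (t + 4).choose 4 = (t + 4) * (t + 3) * (t + 2) * (t + 1) := by
  have h := Nat.add_one_mul_choose_eq (t + 3) 3
  -- h : (t+4) * (t+3).choose 3 = (t+4).choose 4 * 4
  have h3 := six_mul_choose_three t
  nlinarith [h, h3]

/-- k = 1 (sharp at n = 8): `10 n² ≤ C(n,2)²` for `n ≥ 8`. -/
lemma ineq_k1 (n : ℕ) (hn : 8 ≤ n) : 10 * n ^ 2 ≤ (n.choose 2) ^ 2 := by
  obtain ⟨t, rfl⟩ : ∃ t, n = t + 8 := ⟨n - 8, by omega⟩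
  have h := two_mul_choose_two (t + 6)
  -- 2 * C(t+8, 2) = (t+8)(t+7)
  have h' : 2 * (t + 8).choose 2 = (t + 8) * (t + 7) := by
    simpa [show t + 6 + 2 = t + 8 by omega, show t + 6 + 1 = t + 7 by omega] using h
  nlinarith [h', sq_nonneg ((t + 8).choose 2), sq_nonneg t]

/-- k = 2: `19 n² ≤ C(n,3)²` for `n ≥ 7`. -/
lemma ineq_k2 (n : ℕ) (hn : 7 ≤ n) : 19 * n ^ 2 ≤ (n.choose 3) ^ 2 := by
  obtain ⟨t, rfl⟩ : ∃ t, n = t + 7 := ⟨n - 7, by omega⟩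
  have h := six_mul_choose_three (t + 4)
  have h' : 6 * (t + 7).choose 3 = (t + 7) * (t + 6) * (t + 5) := by
    simpa [show t + 4 + 3 = t + 7 by omega, show t + 4 + 2 = t + 6 by omega,
      show t + 4 + 1 = t + 5 by omega] using h
  nlinarith [h', sq_nonneg ((t + 7).choose 3), sq_nonneg t, mul_self_nonneg (t * t)]

/-- k = 3 representative: `20 n² ≤ C(n,4)²` for `n ≥ 7`. -/
lemma ineq_k3 (n : ℕ) (hn : 7 ≤ n) : 20 * n ^ 2 ≤ (n.choose 4) ^ 2 := by
  obtain ⟨t, rfl⟩ : ∃ t, n = t + 7 := ⟨n - 7, by omega⟩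
  have h := tf_mul_choose_four (t + 3)
  have h' : 24 * (t + 7).choose 4 = (t + 7) * (t + 6) * (t + 5) * (t + 4) := by
    simpa [show t + 3 + 4 = t + 7 by omega, show t + 3 + 3 = t + 6 by omega,
      show t + 3 + 2 = t + 5 by omega, show t + 3 + 1 = t + 4 by omega] using h
  nlinarith [h', sq_nonneg ((t + 7).choose 4), sq_nonneg t, mul_self_nonneg (t * t),
    mul_self_nonneg (t * t * t)]

/-- Binomial coefficients increase up to the middle: `C(n,r) ≤ C(n,s)` for `r ≤ s ≤ n/2`. -/
private lemma choose_mono_left_half (n r s : ℕ) (hrs : r ≤ s) (hs : s ≤ n / 2) :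
    n.choose r ≤ n.choose s := by
  induction s, hrs using Nat.le_induction with
  | base => exact le_rfl
  | succ s hrs ih =>
    have hs' : s ≤ n / 2 := by omega
    have step : n.choose s ≤ n.choose (s + 1) :=
      Nat.choose_le_succ_of_lt_half_left (by omega)
    exact (ih hs').trans step

/-- `C(n,4) ≤ C(n,k+1)` for `3 ≤ k ≤ (n-1)/2` (so `k+1 ≤ (n+1)/2`). -/
lemma choose_four_le (n k : ℕ) (hk3 : 3 ≤ k) (hk : k ≤ (n - 1) / 2) (hn : 7 ≤ n) :
    n.choose 4 ≤ n.choose (k + 1) := by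
  rcases Nat.lt_or_ge (k + 1) (n / 2 + 1) with h | h
  · -- k+1 ≤ n/2 : climb
    exact choose_mono_left_half n 4 (k + 1) (by omega) (by omega)
  · -- k+1 > n/2, but k ≤ (n-1)/2 ⇒ n odd and k+1 = (n+1)/2 ; use symmetry C(n,k+1) = C(n, n-(k+1)) with n-(k+1) = k ≤ n/2
    have hodd : n = 2 * k + 1 := by omega
    rcases Nat.lt_or_ge k 4 with hk4 | hk4
    · -- k = 3 and n = 7: C(7,4) ≤ C(7,4)
      have hk3' : k = 3 := by omega
      subst hk3'
      have hn7 : n = 7 := by omega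
      subst hn7
      decide
    · have hsym : n.choose (k + 1) = n.choose k := by
        have := Nat.choose_symm (show k + 1 ≤ n by omega)
        -- this : n.choose (n - (k+1)) = n.choose (k+1)
        rw [show n - (k + 1) = k by omega] at this
        exact this.symm
      rw [hsym]
      exact choose_mono_left_half n 4 k hk4 (by omega)

/-- LEMMA A, instance m = 3 (the stage-2 criterion): for `n ≥ 8` and every `k ≤ (n-1)/2`,
`S3 k · n² ≤ C(n,k+1)²`. -/
theorem perk_criterion_m3 (n : ℕ) (hn : 8 ≤ n) (k : ℕ) (hk : k ≤ (n - 1) / 2) :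
    S3 k * n ^ 2 ≤ (n.choose (k + 1)) ^ 2 := by
  rcases Nat.lt_or_ge k 3 with h | h
  · interval_cases k
    · simp [S3_zero]
    · rw [S3_one]; exact ineq_k1 n hn
    · rw [S3_two]; exact ineq_k2 n (by omega)
  · rw [S3_of_three_le k h]
    calc 20 * n ^ 2 ≤ (n.choose 4) ^ 2 := ineq_k3 n (by omega)
      _ ≤ (n.choose (k + 1)) ^ 2 := by
          have := choose_four_le n k h hk (by omega)
          exact Nat.pow_le_pow_left this 2

/-- Sharpness of the k = 1 threshold: at n = 7 the inequality fails (10·49 = 490 > 441 = 21²). -/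
example : ¬ (10 * 7 ^ 2 ≤ (Nat.choose 7 2) ^ 2) := by decide

end SF6Stage2


/-!
# S-F-6 smoothing arithmetic (theory-2 gen 5 scratch; Mathlib only; for lit-2 to re-home)

CF3-THEOREM §3a in integer form: with
`ltCount n c k = Σ_{i,j : Fin n} C(i,k)·C(j,k)·C(i·n+j, c)` (the leading-term count, `c = n²-1-p`),
Chebyshev's sum inequality twice and the hockey stick give
`C(n,k+1)² · C(n², c+1) ≤ n² · ltCount n c k`, i.e. `Λ₁ ≤ LT` after `C(n²,c+1) = C(n²,p)`.
Honest framing: arithmetic lemmas only; nothing here is a claim on VP vs VNP or P vs NP.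
-/

namespace SF6Smoothing

open Finset

open DetKYLeadingTerms (ltCount)

/-- Hockey stick in `range` form: `Σ_{m<N} C(m,c) = C(N,c+1)`. -/
lemma sum_range_choose_eq (N c : ℕ) : ∑ m ∈ range N, m.choose c = N.choose (c + 1) := by
  induction N with
  | zero => simp
  | succ N ih => rw [sum_range_succ, ih, Nat.choose_succ_succ' N c, add_comm]

/-- The same over `Fin N`. -/
lemma sum_fin_choose_eq (N c : ℕ) : ∑ m : Fin N, (m : ℕ).choose c = N.choose (c + 1) := by
  rw [Fin.sum_univ_eq_sum_range (fun m => m.choose c) N, sum_range_choose_eq]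

/-- `Σ_{i<n} C(i,k) = C(n,k+1)` over `Fin n`. -/
lemma sum_fin_choose (n k : ℕ) : ∑ i : Fin n, (i : ℕ).choose k = n.choose (k + 1) :=
  sum_fin_choose_eq n k

/-- The double sum of `C(i·n+j, c)` over `Fin n × Fin n` is the single sum over `Fin (n·n)`. -/
lemma sum_sum_pos_choose (n c : ℕ) :
    ∑ i : Fin n, ∑ j : Fin n, ((i : ℕ) * n + j).choose c = (n * n).choose (c + 1) := by
  rw [← sum_fin_choose_eq (n * n) c]
  rw [← Finset.sum_product' (f := fun (i : Fin n) (j : Fin n) => ((i : ℕ) * n + j).choose c)]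
  rw [show (univ : Finset (Fin n)) ×ˢ (univ : Finset (Fin n)) = univ from Finset.univ_product_univ]
  rw [← Equiv.sum_comp finProdFinEquiv.symm (fun ij : Fin n × Fin n => ((ij.1 : ℕ) * n + ij.2).choose c)]
  refine Finset.sum_congr rfl fun m _ => ?_
  congr 1
  -- value of finProdFinEquiv.symm m : (m / n? , m % n) with ↑(sym m).1 * n + ↑(sym m).2 = m
  have h := congrArg Fin.val (finProdFinEquiv.apply_symm_apply m)
  simp only [finProdFinEquiv_apply_val] at h
  -- h : ↑(sym m).2 + n * ↑(sym m).1 = ↑m   (shape of finProdFinEquiv)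
  linarith [h]

/-- Inner Chebyshev: for fixed `i`, `C(n,k+1) · G i ≤ n · Σ_j C(j,k)·C(i n + j, c)`. -/
lemma inner_chebyshev (n c k : ℕ) (i : Fin n) :
    n.choose (k + 1) * ∑ j : Fin n, ((i : ℕ) * n + j).choose c ≤
      n * ∑ j : Fin n, (j : ℕ).choose k * ((i : ℕ) * n + j).choose c := by
  have hf : Monotone fun j : Fin n => (j : ℕ).choose k :=
    fun a b hab => Nat.choose_mono k (Fin.le_iff_val_le_val.mp hab)
  have hg : Monotone fun j : Fin n => ((i : ℕ) * n + j).choose c :=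
    fun a b hab => Nat.choose_mono c (by have := Fin.le_iff_val_le_val.mp hab; omega)
  have := (hf.monovary hg).sum_mul_sum_le_card_mul_sum
  simpa [sum_fin_choose, Fintype.card_fin] using this

/-- Outer Chebyshev: `C(n,k+1) · Σ_i G i ≤ n · Σ_i C(i,k)·G i` with `G i = Σ_j C(i n + j, c)` monotone. -/
lemma outer_chebyshev (n c k : ℕ) :
    n.choose (k + 1) * ∑ i : Fin n, ∑ j : Fin n, ((i : ℕ) * n + j).choose c ≤
      n * ∑ i : Fin n, (i : ℕ).choose k * ∑ j : Fin n, ((i : ℕ) * n + j).choose c := by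
  have hf : Monotone fun i : Fin n => (i : ℕ).choose k :=
    fun a b hab => Nat.choose_mono k (Fin.le_iff_val_le_val.mp hab)
  have hg : Monotone fun i : Fin n => ∑ j : Fin n, ((i : ℕ) * n + j).choose c := by
    intro a b hab
    refine Finset.sum_le_sum fun j _ => Nat.choose_mono c ?_
    have := Fin.le_iff_val_le_val.mp hab
    nlinarith
  have := (hf.monovary hg).sum_mul_sum_le_card_mul_sum
  simpa [sum_fin_choose, Fintype.card_fin] using this

/-- **Smoothing (CF3 §3a, integer form).** `C(n,k+1)² · C(n², c+1) ≤ n² · ltCount n c k`. -/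
theorem smoothing (n c k : ℕ) :
    (n.choose (k + 1)) ^ 2 * (n * n).choose (c + 1) ≤ n ^ 2 * ltCount n c k := by
  -- n · ltCount = Σ_i a_i · (n · Σ_j a_j g_ij) ≥ Σ_i a_i · C(n,k+1) · G_i
  have h1 : n.choose (k + 1) * ∑ i : Fin n, (i : ℕ).choose k * ∑ j : Fin n, ((i : ℕ) * n + j).choose c
      ≤ n * ltCount n c k := by
    unfold ltCount
    rw [Finset.mul_sum, Finset.mul_sum]
    refine Finset.sum_le_sum fun i _ => ?_
    have hi := inner_chebyshev n c k i
    -- a_i * (C * G_i) ≤ a_i * (n * Σ_j a_j g_ij)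
    have := Nat.mul_le_mul_left ((i : ℕ).choose k) hi
    calc n.choose (k + 1) * ((i : ℕ).choose k * ∑ j : Fin n, ((i : ℕ) * n + j).choose c)
        = (i : ℕ).choose k * (n.choose (k + 1) * ∑ j : Fin n, ((i : ℕ) * n + j).choose c) := by ring
      _ ≤ (i : ℕ).choose k * (n * ∑ j : Fin n, (j : ℕ).choose k * ((i : ℕ) * n + j).choose c) := this
      _ = n * ∑ j : Fin n, (i : ℕ).choose k * (j : ℕ).choose k * ((i : ℕ) * n + j).choose c := by
          rw [Finset.mul_sum, Finset.mul_sum, Finset.mul_sum]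
          refine Finset.sum_congr rfl fun j _ => ?_
          ring
  have h2 := outer_chebyshev n c k
  rw [sum_sum_pos_choose] at h2
  -- combine: C² · C(N,c+1) = C · (C · ΣG) ≤ C · (n · Σ a_i G_i) = n · (C · Σ a_i G_i) ≤ n · (n · LT)
  calc (n.choose (k + 1)) ^ 2 * (n * n).choose (c + 1)
      = n.choose (k + 1) * (n.choose (k + 1) * (n * n).choose (c + 1)) := by ring
    _ ≤ n.choose (k + 1) * (n * ∑ i : Fin n, (i : ℕ).choose k * ∑ j : Fin n, ((i : ℕ) * n + j).choose c) :=
        Nat.mul_le_mul_left _ h2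
    _ = n * (n.choose (k + 1) * ∑ i : Fin n, (i : ℕ).choose k * ∑ j : Fin n, ((i : ℕ) * n + j).choose c) := by
        ring
    _ ≤ n * (n * ltCount n c k) := Nat.mul_le_mul_left _ h1
    _ = n ^ 2 * ltCount n c k := by ring

/-- The `Λ₁` form used in CF3 §4: with `c = n²-1-p`, `C(n², c+1) = C(n², p)`. -/
theorem lambda1_le (n p k : ℕ) (hp : p + 1 ≤ n * n) :
    (n.choose (k + 1)) ^ 2 * (n * n).choose p ≤ n ^ 2 * ltCount n (n * n - 1 - p) k := by
  have h := smoothing n (n * n - 1 - p) k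
  have hc : n * n - 1 - p + 1 = n * n - p := by omega
  rw [hc, Nat.choose_symm (by omega : p ≤ n * n)] at h
  exact h

/-- Sanity: `ltCount 3 c k` agrees with the memo's det₃ numbers, e.g. ltCount(3,p=4,k=1) = 361 (c = 9-1-4 = 4). -/
example : ltCount 3 4 1 = 361 := by decide
/-- c ≠ p sanity: memo ltCount(3,p=2,k=1) = 126 ↔ `ltCount 3 6 1`; memo ltCount(3,p=6,k=1) = 180 ↔ `ltCount 3 2 1`; ltCount(3,p=7,k=2) = 8 ↔ `ltCount 3 1 2`. -/
example : ltCount 3 6 1 = 126 := by decide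
example : ltCount 3 2 1 = 180 := by decide
example : ltCount 3 1 2 = 8 := by decide

end SF6Smoothing

/-! ## Glue: the primal stage-2 cell inequality for m = 3, n ≥ 8, k ≤ (n-1)/2 -/

namespace SF6Glue

/-- **Stage-2 primal cell (m = 3).** For `n ≥ 8`, `k ≤ (n-1)/2`, `p+1 ≤ n²`:
`S3 k · C(n²,p) ≤ ltCount n (n²-1-p) k` — i.e. the no-syzygy bound of the padded `per₃` side is below the
leading-term count of the `det_n` side (CF3-THEOREM §4, U⁺ ≤ Λ₁ ≤ LT). The dual cells `k > (n-1)/2` follow by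
applying this at `(n²-1-p, n-1-k)` after the transpose duality (S-F-6 (iii)). -/
theorem stage2_primal_cell (n p k : ℕ) (hn : 8 ≤ n) (hk : k ≤ (n - 1) / 2) (hp : p + 1 ≤ n * n) :
    SF6Stage2.S3 k * (n * n).choose p ≤ DetKYLeadingTerms.ltCount n (n * n - 1 - p) k := by
  have h1 := SF6Stage2.perk_criterion_m3 n hn k hk
  have h2 := SF6Smoothing.lambda1_le n p k hp
  have hn0 : 0 < n ^ 2 := by positivity
  have h3 : SF6Stage2.S3 k * (n * n).choose p * n ^ 2 ≤ DetKYLeadingTerms.ltCount n (n * n - 1 - p) k * n ^ 2 :=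
    calc SF6Stage2.S3 k * (n * n).choose p * n ^ 2
        = (SF6Stage2.S3 k * n ^ 2) * (n * n).choose p := by ring
      _ ≤ (n.choose (k + 1)) ^ 2 * (n * n).choose p := Nat.mul_le_mul_right _ h1
      _ ≤ n ^ 2 * DetKYLeadingTerms.ltCount n (n * n - 1 - p) k := h2
      _ = DetKYLeadingTerms.ltCount n (n * n - 1 - p) k * n ^ 2 := by ring
  exact Nat.le_of_mul_le_mul_right h3 hn0

end SF6Glue

/-! ## The packaged stage-2 cell inequality (obligation node of this module, PROVED) -/

/-- **Stage-2 primal cell bound (m = 3, n ≥ 8).** For `n ≥ 8`, `k ≤ (n-1)/2`, `p+1 ≤ n²`: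
`S3 k · C(n²,p) ≤ ltCount(n, n²-1-p, k)` — the no-syzygy bound of the padded-`per₃` side is below the leading-term count of the
`det_n` side (CF3-THEOREM §4: `U⁺ ≤ Λ₁ ≤ LT`). A statement of the cell, PROVED below; not a published theorem. [folklore] -/
def SF6StageTwoCellBound : Prop :=
  ∀ n p k : ℕ, 8 ≤ n → k ≤ (n - 1) / 2 → p + 1 ≤ n * n →
    SF6Stage2.S3 k * (n * n).choose p ≤ DetKYLeadingTerms.ltCount n (n * n - 1 - p) k

/-- `SF6StageTwoCellBound` holds (theory-2's `stage2_primal_cell`). [folklore] -/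
theorem sF6StageTwoCellBound_holds : SF6StageTwoCellBound :=
  fun n p k hn hk hp => SF6Glue.stage2_primal_cell n p k hn hk hp

end Summit.PneNP.GCT
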